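import Mathlib.MeasureTheory.Integral.Bochner.Set
import Mathlib.Order.Filter.AtTopBot.Basic
import Mathlib.Topology.MetricSpace.Basic
import Mathlib.MeasureTheory.Constructions.BorelSpace.Basic
import HarnessLib

/-!
# Crux `BlockLipschitzL` (stmt-QuantumFields-23533) ∕ `HistoryTailL` (stmt-QuantumFields-19936), LINE 25 `CompactnessTransfer`, S1″ side, row (C)
# «compactness of minimising maps» — brick (C-d0) «THE CONTINUUM SHELL PIGEONHOLE, UNIFORM ALONG A SUBSEQUENCE»

Cell `ym3-torus` (YM ladder rung R3 = continuum SU(2) Yang–Mills on T³ — a RUNG, NOT the Clay problem: not d = 4, not infinite volume, not a mass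
gap); width seat `ym3-torus-px14` g6 (offer 14:16Z to the (C)-PROOF pen-namer w2 g13 / LEAD ★w1-19936 g10).  Helper `--supports stmt-QuantumFields-23533`;
THEOREMS ONLY (0 `def`, 0 `sorry`, default heartbeats); Mathlib-only (no cell olean).

THE ROLE.  Step (C-d) «competitor transfer» of the Hardt–Kinderlehrer–Lin road to (C) glues a competitor `v` of the limit map to the
`j`-th minimiser `u_j` across ONE thin spherical shell among `N` candidate shells of an annulus; the shell must carry at most `1∕N` of the annulus
energy, and — since the comparison is made for every large `j` — the SAME shell must be good along a whole subsequence («choose shells by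
pigeonhole on `Σ_shells E(u_j; shell) ≤ Λ` uniformly in `j`; diagonalise once», LEAD 13:49:46Z (2)).  This file is that bookkeeping and nothing else.

WHAT IS PROVED (ns `…Theorems.PoincareLipschitzShellPigeonhole`).
* §1 ★ `exists_fin_mul_setIntegral_le` — ABSTRACT PIGEONHOLE FOR INTEGRALS: for finitely many (`N ≥ 1`) pairwise disjoint measurable sets `A i` and `f`
  integrable on each, some `i` has `N · ∫_{A i} f ≤ ∫_{⋃ A} f` (minimum ≤ mean; NO sign hypothesis).
* §2 radial shells `{x | r + i·h ≤ dist x y ∧ dist x y < r + (i+1)·h}` in a metric measurable space: `measurableSet_shell`, `disjoint_shell`,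
  `iUnion_shell_eq` (their union over `i < N` is the annulus `{r ≤ dist x y < r + N·h}`), ★ `exists_shell_mul_setIntegral_le` (the radial instance).
* §3 ★ `exists_const_index_subseq` — INFINITE PIGEONHOLE: a sequence with values in `Fin N` is constant along a strictly increasing subsequence.
* §4 ★★ `exists_shell_subseq_mul_setIntegral_le` — THE (C-d) SOCKET: for a sequence `f j` integrable on the annulus with `∫_{annulus} f j ≤ Λ` for all
  `j`, ONE shell `i < N` and ONE strictly increasing `φ` with `N · ∫_{shell i} f (φ j) ≤ Λ` for every `j`.
HONEST SCOPE.  Measure-theoretic bookkeeping; nothing of (C) `MinimisingMapCompactness`, (RS), S1″, the organ, `BlockLipschitzL`, `HistoryTailL`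
is proved here; YM₃ on T³ is rung R3, not Clay; YM gap NOT proved; no summit statement is proved here.

References: R. Hardt, D. Kinderlehrer, F.-H. Lin, Comm. Math. Phys. 105 (1986) 547–570, §2 (choice of a good shell); L. Simon, *Theorems on Regularity and
Singularity of Energy Minimizing Maps* (1996) §2.8–§2.9 (the same Fubini/pigeonhole choice). [folklore]
-/

set_option autoImplicit false

noncomputable section

open MeasureTheory Filter Set Function
open scoped BigOperators Topology

namespace Summit.QuantumFields.YangMills.Theorems.PoincareLipschitzShellPigeonhole

/-! ## §1 Abstract pigeonhole for integrals -/

/-- ★ **MINIMUM ≤ MEAN FOR SET INTEGRALS.**  For `N ≥ 1` pairwise disjoint measurable sets `A i` (`i : Fin N`) and `f` integrable on each of them,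
some index has `N · ∫_{A i} f ≤ ∫_{⋃ i, A i} f`.  No sign hypothesis on `f`. [folklore] -/
theorem exists_fin_mul_setIntegral_le {X : Type*} [MeasurableSpace X] (μ : Measure X) {N : ℕ} (hN : 0 < N)
    (A : Fin N → Set X) (hAm : ∀ i, MeasurableSet (A i)) (hAd : Pairwise (Disjoint on A))
    {f : X → ℝ} (hf : ∀ i, IntegrableOn f (A i) μ) :
    ∃ i : Fin N, (N : ℝ) * ∫ x in A i, f x ∂μ ≤ ∫ x in ⋃ i, A i, f x ∂μ := by
  haveI : Nonempty (Fin N) := ⟨⟨0, hN⟩⟩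
  have hsum : ∫ x in ⋃ i, A i, f x ∂μ = ∑ i, ∫ x in A i, f x ∂μ := integral_iUnion_fintype hAm hAd hf
  set T : ℝ := ∫ x in ⋃ i, A i, f x ∂μ with hT
  -- the mean of the `N` numbers `∫_{A i} f` is `T / N`
  have hmean : ∑ i : Fin N, ∫ x in A i, f x ∂μ ≤ ∑ _i : Fin N, T / N := by
    rw [← hsum, Finset.sum_const, Finset.card_univ, Fintype.card_fin, nsmul_eq_mul]
    have hN' : (N : ℝ) ≠ 0 := by exact_mod_cast hN.ne'
    rw [mul_div_cancel₀ _ hN']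
  obtain ⟨i, -, hi⟩ := Finset.exists_le_of_sum_le Finset.univ_nonempty hmean
  refine ⟨i, ?_⟩
  have hN0 : (0 : ℝ) < N := by exact_mod_cast hN
  calc (N : ℝ) * ∫ x in A i, f x ∂μ ≤ (N : ℝ) * (T / N) := mul_le_mul_of_nonneg_left hi hN0.le
    _ = T := mul_div_cancel₀ _ hN0.ne'

/-! ## §2 Radial shells -/

section Shells

variable {X : Type*} [MetricSpace X] [MeasurableSpace X] [OpensMeasurableSpace X]

/-- The `i`-th spherical shell of inner radius `r + i·h` and thickness `h` about `y` is measurable. [folklore] -/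
theorem measurableSet_shell (y : X) (r h : ℝ) (i : ℕ) :
    MeasurableSet {x : X | r + i * h ≤ dist x y ∧ dist x y < r + (i + 1) * h} := by
  have hc : Measurable fun x : X => dist x y := (continuous_id.dist continuous_const).measurable
  exact (measurableSet_le measurable_const hc).inter (measurableSet_lt hc measurable_const)

omit [MeasurableSpace X] [OpensMeasurableSpace X] in
/-- Distinct shells of the same family are disjoint (`h ≥ 0`). [folklore] -/
theorem disjoint_shell (y : X) (r : ℝ) {h : ℝ} (hh : 0 ≤ h) {N : ℕ} :
    Pairwise (Disjoint on fun i : Fin N => {x : X | r + (i : ℕ) * h ≤ dist x y ∧ dist x y < r + ((i : ℕ) + 1) * h}) := by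
  intro i j hij
  rw [Function.onFun, Set.disjoint_left]
  intro x hxi hxj
  have hne : (i : ℕ) ≠ (j : ℕ) := fun h => hij (Fin.ext h)
  rcases lt_or_gt_of_ne hne with hlt | hlt
  · -- `i < j`: upper end of shell `i` ≤ lower end of shell `j`
    have hle : ((i : ℕ) + 1 : ℝ) * h ≤ ((j : ℕ) : ℝ) * h :=
      mul_le_mul_of_nonneg_right (by exact_mod_cast Nat.succ_le_of_lt hlt) hh
    linarith [hxi.2, hxj.1]
  · have hle : ((j : ℕ) + 1 : ℝ) * h ≤ ((i : ℕ) : ℝ) * h :=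
      mul_le_mul_of_nonneg_right (by exact_mod_cast Nat.succ_le_of_lt hlt) hh
    linarith [hxj.2, hxi.1]

omit [MeasurableSpace X] [OpensMeasurableSpace X] in
/-- The `N` shells of thickness `h > 0` tile the annulus `{r ≤ dist x y < r + N·h}`. [folklore] -/
theorem iUnion_shell_eq (y : X) (r : ℝ) {h : ℝ} (hh : 0 < h) (N : ℕ) :
    (⋃ i : Fin N, {x : X | r + (i : ℕ) * h ≤ dist x y ∧ dist x y < r + ((i : ℕ) + 1) * h}) =
      {x : X | r ≤ dist x y ∧ dist x y < r + N * h} := by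
  ext x
  simp only [Set.mem_iUnion, Set.mem_setOf_eq]
  constructor
  · rintro ⟨i, h1, h2⟩
    have hi0 : (0 : ℝ) ≤ (i : ℕ) * h := mul_nonneg (by exact_mod_cast Nat.zero_le _) hh.le
    have hiN : ((i : ℕ) + 1 : ℝ) * h ≤ (N : ℝ) * h :=
      mul_le_mul_of_nonneg_right (by exact_mod_cast Nat.succ_le_of_lt i.isLt) hh.le
    exact ⟨by linarith, by linarith⟩
  · rintro ⟨h1, h2⟩
    -- the index is `⌊(dist x y − r) ∕ h⌋`
    set t : ℝ := (dist x y - r) / h with ht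
    have ht0 : 0 ≤ t := div_nonneg (by linarith) hh.le
    have htN : t < N := by rw [ht, div_lt_iff₀ hh]; linarith
    have hfl : ⌊t⌋₊ < N := (Nat.floor_lt ht0).mpr htN
    refine ⟨⟨⌊t⌋₊, hfl⟩, ?_, ?_⟩
    · have := Nat.floor_le ht0
      have hmul : (⌊t⌋₊ : ℝ) * h ≤ t * h := mul_le_mul_of_nonneg_right this hh.le
      have : t * h = dist x y - r := by rw [ht]; field_simp
      show r + (⌊t⌋₊ : ℝ) * h ≤ dist x y
      linarith
    · have := Nat.lt_floor_add_one t
      have hmul : t * h < ((⌊t⌋₊ : ℝ) + 1) * h := mul_lt_mul_of_pos_right this hh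
      have : t * h = dist x y - r := by rw [ht]; field_simp
      show dist x y < r + ((⌊t⌋₊ : ℝ) + 1) * h
      linarith

/-- ★ **THE RADIAL PIGEONHOLE.**  If `f` is integrable on the annulus `{r ≤ dist x y < r + N·h}` (`N ≥ 1`, `h > 0`), then one of the `N` shells of
thickness `h` carries at most `1∕N` of the annulus integral: `N · ∫_{shell i} f ≤ ∫_{annulus} f`.  No sign hypothesis. [folklore] -/
theorem exists_shell_mul_setIntegral_le (μ : Measure X) (y : X) (r : ℝ) {h : ℝ} (hh : 0 < h) {N : ℕ} (hN : 0 < N)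
    {f : X → ℝ} (hf : IntegrableOn f {x : X | r ≤ dist x y ∧ dist x y < r + N * h} μ) :
    ∃ i : ℕ, i < N ∧ (N : ℝ) * ∫ x in {x : X | r + i * h ≤ dist x y ∧ dist x y < r + (i + 1) * h}, f x ∂μ ≤
      ∫ x in {x : X | r ≤ dist x y ∧ dist x y < r + N * h}, f x ∂μ := by
  set A : Fin N → Set X := fun i => {x : X | r + (i : ℕ) * h ≤ dist x y ∧ dist x y < r + ((i : ℕ) + 1) * h} with hA
  have hU : (⋃ i, A i) = {x : X | r ≤ dist x y ∧ dist x y < r + N * h} := iUnion_shell_eq y r hh N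
  have hfi : ∀ i, IntegrableOn f (A i) μ := fun i =>
    hf.mono_set (by rw [← hU]; exact Set.subset_iUnion A i)
  obtain ⟨i, hi⟩ := exists_fin_mul_setIntegral_le μ hN A (fun i => measurableSet_shell y r h i)
    (disjoint_shell y r hh.le) hfi
  refine ⟨i, i.isLt, ?_⟩
  rw [← hU]
  exact hi

end Shells

/-! ## §3 Infinite pigeonhole along a sequence -/

/-- ★ **A `Fin N`-VALUED SEQUENCE IS CONSTANT ALONG A SUBSEQUENCE.** [folklore] -/
theorem exists_const_index_subseq {N : ℕ} (ι : ℕ → Fin N) :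
    ∃ (i₀ : Fin N) (φ : ℕ → ℕ), StrictMono φ ∧ ∀ j, ι (φ j) = i₀ := by
  -- some value is taken frequently
  have hfreq : ∃ i₀ : Fin N, ∃ᶠ j in atTop, ι j = i₀ := by
    by_contra hcon
    have hcon' : ∀ i : Fin N, ∀ᶠ j in atTop, ι j ≠ i := fun i =>
      (not_frequently.1 fun h => hcon ⟨i, h⟩).mono fun j hj => hj
    have hall : ∀ᶠ j in atTop, ∀ i : Fin N, ι j ≠ i := eventually_all.2 hcon'
    obtain ⟨j, hj⟩ := hall.exists
    exact hj (ι j) rfl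
  obtain ⟨i₀, hi₀⟩ := hfreq
  obtain ⟨φ, hφ, hφi⟩ := extraction_of_frequently_atTop hi₀
  exact ⟨i₀, φ, hφ, hφi⟩

/-! ## §4 The (C-d) socket: one shell, good along a whole subsequence -/

/-- ★★ **ONE SHELL, GOOD ALONG A SUBSEQUENCE.**  Let `f j` (`j : ℕ`) be integrable on the annulus `{r ≤ dist x y < r + N·h}` (`N ≥ 1`, `h > 0`) with
`∫_{annulus} f j ≤ Λ` for every `j`.  Then there are a shell index `i < N` and a strictly increasing `φ : ℕ → ℕ` with
`N · ∫_{shell i} f (φ j) ≤ Λ` for every `j` — the uniform-in-`j` shell choice of the HKL∕Luckhaus competitor transfer. [cite: HardtKinderlehrerLin1986, §2] -/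
theorem exists_shell_subseq_mul_setIntegral_le {X : Type*} [MetricSpace X] [MeasurableSpace X] [OpensMeasurableSpace X]
    (μ : Measure X) (y : X) (r : ℝ) {h : ℝ} (hh : 0 < h) {N : ℕ} (hN : 0 < N) (Λ : ℝ)
    (f : ℕ → X → ℝ) (hf : ∀ j, IntegrableOn (f j) {x : X | r ≤ dist x y ∧ dist x y < r + N * h} μ)
    (hΛ : ∀ j, ∫ x in {x : X | r ≤ dist x y ∧ dist x y < r + N * h}, f j x ∂μ ≤ Λ) :
    ∃ i : ℕ, i < N ∧ ∃ φ : ℕ → ℕ, StrictMono φ ∧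
      ∀ j, (N : ℝ) * ∫ x in {x : X | r + i * h ≤ dist x y ∧ dist x y < r + (i + 1) * h}, f (φ j) x ∂μ ≤ Λ := by
  -- per `j`, a good shell
  have hj : ∀ j, ∃ i : Fin N,
      (N : ℝ) * ∫ x in {x : X | r + (i : ℕ) * h ≤ dist x y ∧ dist x y < r + ((i : ℕ) + 1) * h}, f j x ∂μ ≤ Λ := by
    intro j
    obtain ⟨i, hi, hle⟩ := exists_shell_mul_setIntegral_le μ y r hh hN (hf j)
    exact ⟨⟨i, hi⟩, hle.trans (hΛ j)⟩
  choose ι hι using hj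
  obtain ⟨i₀, φ, hφ, hφi⟩ := exists_const_index_subseq ι
  refine ⟨i₀, i₀.isLt, φ, hφ, fun j => ?_⟩
  have := hι (φ j)
  rwa [hφi j] at this

end Summit.QuantumFields.YangMills.Theorems.PoincareLipschitzShellPigeonhole

end
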